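import Summits.AtomisticToContinuum.HydrodynamicLimit.Theorems.InformationPercolationEngineChaosClosesEulerDissipationRigidityA
import HarnessLib

/-!
# Dissipation rigidity — F: the coarse-grained objects along a weakly convergent sequence

Helper for the line `empirical-h-theorem` of the crux `InformationPercolationEngine.ChaosClosesEuler`
(stmt-AtomisticToContinuum-15141), registered stub `stub_dissipationRigidity`.

At a fixed coarse-graining `δ > 0`, along finite measures `mₖ ⇀ m` on `ℝ³`:

* `g_k(v) = ∫ φδ(v − w) dmₖ(w) → g(v)` pointwise (the translates of `φδ` are bounded continuous);
* on the class {mass `≥ ρ₁`, tail `∫_{Lt 0<|v|} |v|² ≤ 1`} every measure charges the closed ball of radius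
  `R₀ = max (Lt 0) (max 1 √(2/ρ₁))` with mass `≥ ρ₁/2` (Chebyshev), whence the UNIFORM two-sided bound
  `|log g_k(u)| ≤ A + |u|²/δ²` (file A);
* with floors `K_k → ∞` (`K_k ≥ 0`), the floored logarithms `ℓ_{K_k}(u, g_k(u)) → log g(u)` pointwise and
  are dominated by `A + |u|²/δ²`, so the smoothed exponents
  `Λ_k(v) = ∫ φδ(v − u) ℓ_{K_k}(u, g_k(u)) du → Λ(v) = ∫ φδ(v − u) log g(u) du` pointwise (dominated
  convergence), all of them continuous (file A);
* the Gaussian coarse-graining of a quadratic polynomial: `φδ ∗ (a + ⟪b,·⟫ + c|·|²) = a + 3cδ² + ⟪b,·⟫ + c|·|²`.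

References: folklore (weak convergence, dominated convergence); C. Cercignani, R. Illner, M. Pulvirenti (1994) §3.2.
-/

noncomputable section

namespace Summit.AtomisticToContinuum.HydrodynamicLimit.Theorems.ChaosClosesEulerDissipationRigidity

open scoped BigOperators Topology Classical MeasureTheory ENNReal InnerProductSpace
open Filter Set MeasureTheory
open Literature.MathematicalPhysics.KineticTheory
open Literature.Analysis.FluidPDE
open Summit.AtomisticToContinuum.HydrodynamicLimit.Theorems

/-! ## Pointwise convergence of the coarse-grained laws -/

/-- **`g_k → g` pointwise** along a weakly convergent sequence of finite measures. [folklore] -/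
theorem tendsto_smoothedLaw {θ : ℝ} (hθ : 0 < θ) {μs : ℕ → FiniteMeasure V3} {μ : FiniteMeasure V3}
    (hconv : Tendsto μs atTop (𝓝 μ)) (v : V3) :
    Tendsto (fun n => ∫ w, localMaxwellian 1 θ 0 (v - w) ∂(μs n : Measure V3)) atTop
      (𝓝 (∫ w, localMaxwellian 1 θ 0 (v - w) ∂(μ : Measure V3))) :=
  EvenStressEnskog.QuadraticTest.tendsto_integral_of_abs_le hconv
    ((continuous_localMaxwellian 1 θ 0).comp (continuous_const.sub continuous_id))
    (B := (2 * Real.pi * θ) ^ (-(Module.finrank ℝ V3 : ℝ) / 2)) fun w => by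
      rw [abs_of_nonneg (localMaxwellian_nonneg zero_le_one hθ.le _ _), phi_sub_eq]
      exact localMaxwellian_le_const hθ w v

/-! ## Uniform mass in a ball on the class -/

/-- **Chebyshev on the class**: a finite measure with mass `≥ ρ₁ > 0` and second-moment tail
`∫_{Lt₀<|v|} |v|² ≤ 1` charges the closed ball of radius `R₀ = max Lt₀ (max 1 √(2/ρ₁))` with mass `≥ ρ₁/2`.
[folklore] -/
theorem half_mass_le_closedBall {m : Measure V3} [IsFiniteMeasure m] (h2 : Integrable (fun v : V3 => ‖v‖ ^ 2) m)
    {ρ₁ Lt₀ : ℝ} (hρ₁ : 0 < ρ₁) (hlo : ρ₁ ≤ (m Set.univ).toReal)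
    (htail : ∫ v in {v : V3 | Lt₀ < ‖v‖}, ‖v‖ ^ 2 ∂m ≤ 1) :
    ρ₁ / 2 ≤ (m (Metric.closedBall (0 : V3) (max Lt₀ (max 1 (Real.sqrt (2 / ρ₁)))))).toReal := by
  set R : ℝ := max Lt₀ (max 1 (Real.sqrt (2 / ρ₁))) with hR
  have hR1 : 1 ≤ R := le_max_of_le_right (le_max_left _ _)
  have hR2 : 2 / ρ₁ ≤ R ^ 2 := by
    have h : Real.sqrt (2 / ρ₁) ≤ R := le_max_of_le_right (le_max_right _ _)
    have h' : Real.sqrt (2 / ρ₁) ^ 2 = 2 / ρ₁ := Real.sq_sqrt (by positivity)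
    nlinarith [Real.sqrt_nonneg (2 / ρ₁)]
  have hRpos : 0 < R := by linarith
  have hSm : MeasurableSet {v : V3 | R < ‖v‖} := measurableSet_lt measurable_const measurable_norm
  -- Chebyshev: `R² m{R < |v|} ≤ ∫_{R<|v|} |v|² ≤ ∫_{Lt₀<|v|} |v|² ≤ 1`
  have h1 : R ^ 2 * m.real {v : V3 | R < ‖v‖} ≤ ∫ v in {v : V3 | R < ‖v‖}, ‖v‖ ^ 2 ∂m :=
    setIntegral_ge_of_const_le_real hSm (measure_ne_top _ _)
      (fun v (hv : R < ‖v‖) => pow_le_pow_left₀ hRpos.le hv.le 2) h2.integrableOn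
  have h3 : ∫ v in {v : V3 | R < ‖v‖}, ‖v‖ ^ 2 ∂m ≤ 1 :=
    (ChaosClosesEulerQuantitativeRigidity.setIntegral_sq_tail_anti h2 (le_max_left _ _)).trans htail
  have h4 : m.real {v : V3 | R < ‖v‖} ≤ ρ₁ / 2 := by
    have h5 : R ^ 2 * m.real {v : V3 | R < ‖v‖} ≤ 1 := h1.trans h3
    have h6 : 2 / ρ₁ * m.real {v : V3 | R < ‖v‖} ≤ 1 :=
      (mul_le_mul_of_nonneg_right hR2 measureReal_nonneg).trans h5
    rw [div_mul_eq_mul_div, div_le_one hρ₁] at h6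
    linarith
  -- complement
  have hcompl : {v : V3 | R < ‖v‖}ᶜ = Metric.closedBall (0 : V3) R := by
    ext v
    simp only [mem_compl_iff, mem_setOf_eq, not_lt, Metric.mem_closedBall, dist_zero_right]
  have h7 : m.real {v : V3 | R < ‖v‖} + m.real (Metric.closedBall (0 : V3) R) = m.real Set.univ := by
    rw [← hcompl, measureReal_add_measureReal_compl hSm]
  rw [measureReal_def, measureReal_def, measureReal_def] at h7
  rw [measureReal_def] at h4
  linarith

/-! ## Uniform logarithmic bounds and the limit of the smoothed exponents -/

/-- **Uniform two-sided logarithmic bound on the class.** If `m` has mass `≤ ρ₂` and charges the closed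
ball of radius `R` with mass `≥ μ₀ > 0`, then for every `u`,
`|log g(u)| ≤ |log c₁| + |log C₂| + |u|²/δ²` with the explicit constants of the statement. [folklore] -/
theorem abs_log_smoothedLaw_le {θ : ℝ} (hθ : 0 < θ) (m : Measure V3) [IsFiniteMeasure m] {R μ₀ ρ₂ : ℝ}
    (hμ₀ : 0 < μ₀) (hR : μ₀ ≤ (m (Metric.closedBall (0 : V3) R)).toReal) (hhi : (m Set.univ).toReal ≤ ρ₂)
    (u : V3) :
    |Real.log (∫ w, localMaxwellian 1 θ 0 (u - w) ∂m)| ≤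
      |Real.log (μ₀ * ((2 * Real.pi * θ) ^ (-(Module.finrank ℝ V3 : ℝ) / 2) * Real.exp (-(2 * R ^ 2) / (2 * θ))))| +
        |Real.log (ρ₂ * (2 * Real.pi * θ) ^ (-(Module.finrank ℝ V3 : ℝ) / 2))| + ‖u‖ ^ 2 / θ := by
  refine abs_log_le_of_bounds hθ (by positivity) (smoothedLaw_ge hθ m hR u) ?_
  exact (smoothedLaw_le hθ m u).trans (mul_le_mul_of_nonneg_right hhi (Real.rpow_nonneg (by positivity) _))

/-- **The floored logarithms converge to the logarithm of the limit**: if `K_k → ∞` and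
`0 < y_k → y > 0`, then `ℓ_{K_k}(u, y_k) → log y` (the floor at `u` tends to `0`, so eventually the floored
logarithm is the logarithm). [folklore] -/
theorem tendsto_flooredLog {K : ℕ → ℝ} (hK : Tendsto K atTop atTop) {y : ℕ → ℝ} {yinf : ℝ} (hyinf : 0 < yinf)
    (hy : Tendsto y atTop (𝓝 yinf)) (u : V3) :
    Tendsto (fun k => if Real.exp (-K k) * ((1 + ‖u‖ ^ 2) ^ 2)⁻¹ ≤ y k then Real.log (y k)
      else Real.log (Real.exp (-K k) * ((1 + ‖u‖ ^ 2) ^ 2)⁻¹) +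
        (y k - Real.exp (-K k) * ((1 + ‖u‖ ^ 2) ^ 2)⁻¹) / (Real.exp (-K k) * ((1 + ‖u‖ ^ 2) ^ 2)⁻¹))
      atTop (𝓝 (Real.log yinf)) := by
  have hfloor : Tendsto (fun k => Real.exp (-K k) * ((1 + ‖u‖ ^ 2) ^ 2)⁻¹) atTop (𝓝 0) := by
    have h := (Real.tendsto_exp_neg_atTop_nhds_zero.comp hK).mul_const ((1 + ‖u‖ ^ 2) ^ 2)⁻¹
    rwa [zero_mul] at h
  have hev : ∀ᶠ k in atTop, Real.exp (-K k) * ((1 + ‖u‖ ^ 2) ^ 2)⁻¹ ≤ y k := by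
    have h1 : ∀ᶠ k in atTop, Real.exp (-K k) * ((1 + ‖u‖ ^ 2) ^ 2)⁻¹ < yinf / 2 :=
      (tendsto_order.1 hfloor).2 _ (by positivity)
    have h2 : ∀ᶠ k in atTop, yinf / 2 < y k := (tendsto_order.1 hy).1 _ (by linarith)
    filter_upwards [h1, h2] with k hk1 hk2
    linarith
  refine ((Real.continuousAt_log hyinf.ne').tendsto.comp hy).congr' ?_
  filter_upwards [hev] with k hk
  rw [Function.comp_apply, if_pos hk]

/-- **Pointwise limit of the smoothed exponents** (dominated convergence). Along `g_k → g` pointwise with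
all `g_k, g` continuous, positive and obeying a common bound `|log g_k(u)|, |log g(u)| ≤ A + |u|²/δ²`, and
floors `K_k → ∞` with `K_k ≥ 0`:
`∫ φδ(v − u) ℓ_{K_k}(u, g_k u) du → ∫ φδ(v − u) log g(u) du` for every `v`. [folklore] -/
theorem tendsto_smoothedExponent {θ : ℝ} (hθ : 0 < θ) {gs : ℕ → V3 → ℝ} {g : V3 → ℝ}
    (hgc : ∀ k, Continuous (gs k)) (hgpos : ∀ k u, 0 < gs k u) (hpos : ∀ u, 0 < g u)
    (hlim : ∀ u, Tendsto (fun k => gs k u) atTop (𝓝 (g u))) {A : ℝ}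
    (hbd : ∀ k u, |Real.log (gs k u)| ≤ A + ‖u‖ ^ 2 / θ)
    {K : ℕ → ℝ} (hK : Tendsto K atTop atTop) (hK0 : ∀ k, 0 ≤ K k) (v : V3) :
    Tendsto (fun k => ∫ u, localMaxwellian 1 θ 0 (v - u) *
        (if Real.exp (-K k) * ((1 + ‖u‖ ^ 2) ^ 2)⁻¹ ≤ gs k u then Real.log (gs k u)
          else Real.log (Real.exp (-K k) * ((1 + ‖u‖ ^ 2) ^ 2)⁻¹) +
            (gs k u - Real.exp (-K k) * ((1 + ‖u‖ ^ 2) ^ 2)⁻¹) / (Real.exp (-K k) * ((1 + ‖u‖ ^ 2) ^ 2)⁻¹)))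
      atTop (𝓝 (∫ u, localMaxwellian 1 θ 0 (v - u) * Real.log (g u))) := by
  refine tendsto_integral_of_dominated_convergence
    (fun u => localMaxwellian 1 θ 0 (v - u) * (|A| + θ⁻¹ * ‖u‖ ^ 2)) (fun k => ?_) ?_ (fun k => ?_) ?_
  · exact (((continuous_localMaxwellian 1 θ 0).comp (continuous_const.sub continuous_id)).mul
      (continuous_flooredLog_comp (K k) (hgc k) (hgpos k))).aestronglyMeasurable
  · have h := integrable_phi_mul hθ (F := fun u : V3 => |A| + θ⁻¹ * ‖u‖ ^ 2) (by fun_prop)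
      (a := |A|) (b := θ⁻¹) (fun u => by rw [abs_of_nonneg (by positivity)]) v
    exact h
  · refine Eventually.of_forall fun u => ?_
    rw [Real.norm_eq_abs, abs_mul, abs_of_nonneg (localMaxwellian_nonneg zero_le_one hθ.le _ _)]
    refine mul_le_mul_of_nonneg_left ?_ (localMaxwellian_nonneg zero_le_one hθ.le _ _)
    refine (abs_flooredLog_le (floor_pos (K k) u) (floor_le_one (hK0 k) u) (hgpos k u)).trans ?_
    refine (hbd k u).trans ?_
    rw [div_eq_inv_mul]
    linarith [le_abs_self A]
  · refine Eventually.of_forall fun u => ?_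
    exact (tendsto_flooredLog hK (hpos u) (hlim u) u).const_mul _

/-! ## The Gaussian coarse-graining of a quadratic polynomial -/

/-- `φδ ∗ (a + ⟪b,·⟫ + c|·|²) = a + 3cθ + ⟪b,·⟫ + c|·|²` (`θ = δ²`): Gaussian coarse-graining maps quadratic
polynomials to quadratic polynomials with the same `b, c`. [folklore] -/
theorem conv_phi_quadratic {θ : ℝ} (hθ : 0 < θ) (a c : ℝ) (b v : V3) :
    ∫ u, localMaxwellian 1 θ 0 (v - u) * (a + ⟪b, u⟫_ℝ + c * ‖u‖ ^ 2) =
      a + 3 * c * θ + ⟪b, v⟫_ℝ + c * ‖v‖ ^ 2 := by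
  have h := integral_localMaxwellian_mul_affine hθ v a (2 * c) b
  have h1 : (fun u : V3 => localMaxwellian 1 θ 0 (v - u) * (a + ⟪b, u⟫_ℝ + c * ‖u‖ ^ 2)) =
      fun u : V3 => localMaxwellian 1 θ v u * (a + ⟪b, u⟫_ℝ + 2 * c * ‖u‖ ^ 2 / 2) := by
    funext u
    rw [phi_sub_eq']
    ring
  rw [h1, h]
  ring

/-! ## Registered sub-goal -/

/-- **Registered sub-goal `stub_dissipationRigidityF` (helper F of `stub_dissipationRigidity`): along floors
`K_k → ∞` and positive values `y_k → y > 0`, the floored logarithms `ℓ_{K_k}(u, y_k)` converge to `log y`.**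
[folklore] -/
theorem stub_dissipationRigidityF : ∀ {K : ℕ → ℝ}, Tendsto K atTop atTop → ∀ {y : ℕ → ℝ} {yinf : ℝ}, 0 < yinf → Tendsto y atTop (𝓝 yinf) → ∀ u : V3, Tendsto (fun k => if Real.exp (-K k) * ((1 + ‖u‖ ^ 2) ^ 2)⁻¹ ≤ y k then Real.log (y k) else Real.log (Real.exp (-K k) * ((1 + ‖u‖ ^ 2) ^ 2)⁻¹) + (y k - Real.exp (-K k) * ((1 + ‖u‖ ^ 2) ^ 2)⁻¹) / (Real.exp (-K k) * ((1 + ‖u‖ ^ 2) ^ 2)⁻¹)) atTop (𝓝 (Real.log yinf)) :=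
  fun hK _ _ hyinf hy u => tendsto_flooredLog hK hyinf hy u

end Summit.AtomisticToContinuum.HydrodynamicLimit.Theorems.ChaosClosesEulerDissipationRigidity

end
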